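import Summits.Parity.GeneralizedHardyLittlewood.Theorems.LeeYangFibresCellParityLawRelDefs
import Summits.Parity.GeneralizedHardyLittlewood.Theorems.LeeYangFibresHyperbolicityClipsParity
import HarnessLib

/-!
# Route `LeeYangFibres`, crux `CellParityLaw` (stmt-Parity-14109), line `section-annihilator`:
# the route's consumer of the crux needs only its relative + absolute form

**Theorem (sorry-free).** `stub_relativeConsumer : CellParityLawRel → FibreHyperbolicity → ModelCellFacts →
PrimeCellsRelative` — the clipping lemma `HyperbolicityClipsParity` (stmt-Parity-14114, landed for the crux as typed)
re-run from the RELATIVE + absolute cell-parity law `CellParityLawRel` (`…CellParityLawRelDefs.lean`): error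
`ε (β_∞ ∏_p β_p (A₁/N)^t + N / log^t N)` instead of `ε N / log^t N`.

Why this is the whole point (lead c4): the crux's purely absolute error is what forces its two non-printed inputs
(the tuple-GEH atom at level `N^{1-(log log N)^{-B}}` and the polynomial-rate Bombieri kernel `EffectiveRoughCellLaw`);
the route's only consumer of the crux is `HyperbolicityClipsParity`, and this file shows, kernel-checked, that the
consumer goes through verbatim from the relative form — the abstract assembly `clipsParity_assembly_rel` below is
`HyperbolicityClipsParity.clipsParity_assembly` with ONE changed estimate, the smallness transfer: with the uniform
per-cell error `E₀ = ε_L (M a₁^t + N / log^t N)` (`M = β_∞ ∏β_p ≥ ηN` in the hyperbolic case, `a_m = A_m(N)/N`,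
`c / log N ≤ a_m` on the bulk indices, `a₁ ≤ 5 / log N`) one has
`E₀ u^{t-1} ≤ ε_L u^{t-1} (5/c + 1/(η c^t)) · M a_m a₁^{t-1}`, so `ε_L = min(ε/2, ε' / (u^{t-1}(5/c + 1/(η c^t))))`
feeds `fibre_clip` exactly as before (`smallness_transfer_rel`); the small-mass case and the final triangle inequality
are unchanged (`|C₁ - X| ≤ ε_L (X + N/log^t N) + |Θ - 1| X`). Constants: `ε → (δ, ε') → u₀ → η → u → (j₁, j₂, c) →
ε_L → N₀` as in the landed file.

References: B. Green, T. Tao, Ann. of Math. 171 (2010), Conj. 1.4 [GreenTao2010]; J. Borcea, P. Brändén, Invent.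
Math. 177 (2009) [BorceaBranden2009] (hyperbolicity input, via the landed `fibre_clip`).
-/

noncomputable section

open scoped BigOperators Classical
open Finset Literature.NumberTheory.Sieve
open Summit.Parity.GeneralizedHardyLittlewood.Theorems.HyperbolicityClipsParity

namespace Summit.Parity.GeneralizedHardyLittlewood.Cruxes.CellParityLaw.SectionAnnihilator

/-- **Smallness transfer, relative form.** From `ε_L u' (5/c + 1/(η c^t)) ≤ ε'`, `ηN ≤ M`, `c/Lg ≤ a_m`,
`c/Lg ≤ a₁ ≤ 5/Lg`: `ε_L (M a₁^t + N / Lg^t) u' ≤ ε' (M a_m) a₁^{t-1}` — the law's relative + absolute error at the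
prime-cell scale is small against every bulk fibre coefficient. -/
theorem RelConsumerAux.smallness_transfer_rel {t : ℕ} (ht : 1 ≤ t)
    {N Lg ε' η c εL u' M am a1 : ℝ} (hN : 0 < N) (hLg : 0 < Lg) (hη : 0 < η)
    (hc : 0 < c) (hεL : 0 ≤ εL) (hu' : 0 ≤ u') (hM : η * N ≤ M) (ham : c / Lg ≤ am) (ha1 : c / Lg ≤ a1)
    (ha1le : a1 ≤ 5 / Lg) (hsmall : εL * u' * (5 / c + 1 / (η * c ^ t)) ≤ ε') :
    εL * (M * a1 ^ t + N / Lg ^ t) * u' ≤ ε' * (M * am) * a1 ^ (t - 1) := by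
  have hcL : 0 < c / Lg := div_pos hc hLg
  have ham0 : 0 < am := lt_of_lt_of_le hcL ham
  have ha10 : 0 < a1 := lt_of_lt_of_le hcL ha1
  have hM0 : 0 < M := lt_of_lt_of_le (mul_pos hη hN) hM
  set P : ℝ := M * am * a1 ^ (t - 1) with hP
  have hP0 : 0 < P := by positivity
  -- (i) `M a₁^t ≤ (5/c) P`
  have h1 : M * a1 ^ t ≤ 5 / c * P := by
    have ha1am : a1 ≤ 5 / c * am := by
      calc a1 ≤ 5 / Lg := ha1le
        _ = 5 / c * (c / Lg) := by field_simp
        _ ≤ 5 / c * am := mul_le_mul_of_nonneg_left ham (by positivity)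
    have : a1 ^ t = a1 ^ (t - 1) * a1 := by
      rw [← pow_succ, Nat.sub_add_cancel ht]
    calc M * a1 ^ t = M * a1 ^ (t - 1) * a1 := by rw [this, mul_assoc]
      _ ≤ M * a1 ^ (t - 1) * (5 / c * am) :=
          mul_le_mul_of_nonneg_left ha1am (by positivity)
      _ = 5 / c * P := by rw [hP]; ring
  -- (ii) `N / Lg^t ≤ P / (η c^t)`
  have h2 : N / Lg ^ t ≤ 1 / (η * c ^ t) * P := by
    have hpow : (c / Lg) ^ (t - 1) ≤ a1 ^ (t - 1) := pow_le_pow_left₀ hcL.le ha1 _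
    have hct : (c / Lg) ^ t ≤ am * a1 ^ (t - 1) := by
      have : (c / Lg) ^ t = (c / Lg) * (c / Lg) ^ (t - 1) := by
        rw [← pow_succ', Nat.sub_add_cancel ht]
      rw [this]
      exact mul_le_mul ham hpow (pow_nonneg hcL.le _) ham0.le
    have hNM : N ≤ M / η := by rw [le_div_iff₀ hη]; linarith [hM]
    have hct' : c ^ t / Lg ^ t ≤ am * a1 ^ (t - 1) := by rwa [div_pow] at hct
    calc N / Lg ^ t = N * (1 / Lg ^ t) := by ring
      _ ≤ M / η * (1 / Lg ^ t) := mul_le_mul_of_nonneg_right hNM (by positivity)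
      _ = 1 / (η * c ^ t) * (M * (c ^ t / Lg ^ t)) := by field_simp
      _ ≤ 1 / (η * c ^ t) * (M * (am * a1 ^ (t - 1))) :=
          mul_le_mul_of_nonneg_left (mul_le_mul_of_nonneg_left hct' hM0.le) (by positivity)
      _ = 1 / (η * c ^ t) * P := by rw [hP]; ring
  calc εL * (M * a1 ^ t + N / Lg ^ t) * u'
      ≤ εL * (5 / c * P + 1 / (η * c ^ t) * P) * u' :=
        mul_le_mul_of_nonneg_right (mul_le_mul_of_nonneg_left (add_le_add h1 h2) hεL) hu'
    _ = εL * u' * (5 / c + 1 / (η * c ^ t)) * P := by ring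
    _ ≤ ε' * P := mul_le_mul_of_nonneg_right hsmall hP0.le
    _ = ε' * (M * am) * a1 ^ (t - 1) := by rw [hP]; ring

/-- **The clipping lemma for abstract cell data, from the RELATIVE + absolute law.** As
`HyperbolicityClipsParity.clipsParity_assembly`, with the law hypothesis weakened to the error
`ε (MS · (A N u 1 / N)^t + N / log^t N)`; conclusion unchanged (the shape of `PrimeCellsRelative`). -/
theorem RelConsumerAux.clipsParity_assembly_rel {t : ℕ} (ht : 1 ≤ t)
    {cell : ℕ → ℕ → (Fin t → AffLinForm 1) → Set (Fin 1 → ℝ) → (Fin t → ℕ) → ℕ}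
    {A : ℕ → ℕ → ℕ → ℕ} {MS : (Fin t → AffLinForm 1) → Set (Fin 1 → ℝ) → ℝ}
    (hAsum : ∀ N u : ℕ, ∑ m ∈ Finset.Icc 1 u, (A N u m : ℝ) ≤ N)
    (hMS0 : ∀ (Ψ : Fin t → AffLinForm 1) (K : Set (Fin 1 → ℝ)), IsNondegenerateSystem Ψ → 0 ≤ MS Ψ K)
    (hLaw : ∀ (L u : ℕ), 2 ≤ u → ∀ ε : ℝ, 0 < ε → ∃ N₀ : ℕ, ∀ N : ℕ, N₀ ≤ N →
      ∀ Ψ : Fin t → AffLinForm 1, IsNondegenerateSystem Ψ → affLinSize Ψ N ≤ L →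
      ∀ K : Set (Fin 1 → ℝ), Convex ℝ K → K ⊆ realBox 1 N →
      ∃ θ : Finset (Fin t) → ℝ, θ ∅ = 1 ∧ (∀ S, |θ S| ≤ 2) ∧ ∀ j : Fin t → ℕ,
        (∀ i, 1 ≤ j i ∧ j i ≤ u) →
        |(cell N u Ψ K j : ℝ) - (∑ S : Finset (Fin t), θ S * ∏ i ∈ S, (-1 : ℝ) ^ (j i + 1)) *
          (MS Ψ K * ∏ i, (A N u (j i) : ℝ) / N)| ≤
          ε * (MS Ψ K * ((A N u 1 : ℝ) / N) ^ t + N / Real.log N ^ t))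
    (hHyp : ∀ (L u₀ : ℕ), ∀ η : ℝ, 0 < η → ∃ u : ℕ, u₀ ≤ u ∧ 2 ≤ u ∧ ∃ N₀ : ℕ, ∀ N : ℕ, N₀ ≤ N →
      ∀ Ψ : Fin t → AffLinForm 1, IsNondegenerateSystem Ψ → affLinSize Ψ N ≤ L →
      ∀ K : Set (Fin 1 → ℝ), Convex ℝ K → K ⊆ realBox 1 N → η * (N : ℝ) ≤ MS Ψ K →
      ∀ i : Fin t, ∀ w : Fin t → ℝ, (∀ k, 0 < w k ∧ w k ≤ 1) → ∀ ζ : ℂ,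
        (∑ j ∈ Fintype.piFinset (fun _ : Fin t => Finset.Icc 1 u),
          ((cell N u Ψ K j : ℕ) : ℂ) * ∏ k, (if k = i then ζ else ((w k : ℝ) : ℂ)) ^ (j k)) = 0 →
        ζ.im = 0)
    (hModel : ∀ ε : ℝ, 0 < ε → ∃ u₀ : ℕ, ∀ u : ℕ, u₀ ≤ u → ∃ j₁ j₂ : ℕ, Odd j₁ ∧ Even j₂ ∧
      2 ≤ j₁ ∧ j₁ + 2 ≤ u ∧ 2 ≤ j₂ ∧ j₂ + 2 ≤ u ∧ ∃ c : ℝ, 0 < c ∧ ∃ N₀ : ℕ, ∀ N : ℕ, N₀ ≤ N →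
      (∀ j ∈ ({1, j₁ - 1, j₁, j₁ + 1, j₂ - 1, j₂, j₂ + 1} : Finset ℕ),
        c * (N : ℝ) / Real.log N ≤ (A N u j : ℝ)) ∧
      (∀ j ∈ ({j₁, j₂} : Finset ℕ),
        (1 - ε) * (A N u j : ℝ) ^ 2 ≤ (A N u (j - 1) : ℝ) * (A N u (j + 1) : ℝ)) ∧
      |∑ j ∈ Finset.Icc 1 u, (-1 : ℝ) ^ j * (A N u j : ℝ)| ≤ ε * ∑ j ∈ Finset.Icc 1 u, (A N u j : ℝ))
    (hA1 : ∀ N u : ℕ, 2 ≤ N → (A N u 1 : ℝ) ≤ 5 * N / Real.log N)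
    (L : ℕ) (ε : ℝ) (hε : 0 < ε) :
    ∃ u : ℕ, 2 ≤ u ∧ ∃ N₀ : ℕ, ∀ N : ℕ, N₀ ≤ N → ∀ Ψ : Fin t → AffLinForm 1,
      IsNondegenerateSystem Ψ → affLinSize Ψ N ≤ L → ∀ K : Set (Fin 1 → ℝ), Convex ℝ K →
      K ⊆ realBox 1 N →
        |(cell N u Ψ K (fun _ => 1) : ℝ) - MS Ψ K * ((A N u 1 : ℝ) / N) ^ t| ≤
          ε * (MS Ψ K * ((A N u 1 : ℝ) / N) ^ t + N / Real.log N ^ t) := by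
  -- constants
  set K₁ : ℝ := 2 ^ t * 8 ^ (t - 1) with hK₁
  have hK₁pos : 0 < K₁ := by positivity
  set δ : ℝ := min (1 / 4) (ε / (4 * K₁ * 2 ^ t)) with hδ_def
  have hδpos : 0 < δ := lt_min (by norm_num) (by positivity)
  have hδ4 : δ ≤ 1 / 4 := min_le_left _ _
  have hδ1 : δ ≤ 1 := by linarith
  have hδK : K₁ * (2 ^ t * δ) ≤ ε / 4 := by
    have h := min_le_right (1 / 4 : ℝ) (ε / (4 * K₁ * 2 ^ t))
    rw [← hδ_def, le_div_iff₀ (by positivity)] at h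
    nlinarith [h]
  set ε' : ℝ := ε / (4 * K₁) with hε'_def
  have hε'pos : 0 < ε' := by positivity
  have hε'K : K₁ * ε' = ε / 4 := by rw [hε'_def]; field_simp
  obtain ⟨u₀, hu₀⟩ := hModel δ hδpos
  set η : ℝ := ε / (4 * 2 ^ t * 5 ^ t) with hη_def
  have hηpos : 0 < η := by positivity
  obtain ⟨u, hu₀u, hu2, N_H, hH⟩ := hHyp L u₀ η hηpos
  obtain ⟨j₁, j₂, hj₁, hj₂, h2j₁, hj₁u, h2j₂, hj₂u, c, hc, N_M, hMod⟩ := hu₀ u hu₀u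
  have hu1 : 1 ≤ u := by omega
  have hupos : (0 : ℝ) < u := by exact_mod_cast (by omega : 0 < u)
  -- the relative smallness constant `Q = u^{t-1} (5/c + 1/(η c^t))`
  set Q : ℝ := (u : ℝ) ^ (t - 1) * (5 / c + 1 / (η * c ^ t)) with hQ_def
  have hQpos : 0 < Q := by positivity
  set ε_L : ℝ := min (ε / 2) (ε' / Q) with hε_L_def
  have hε_Lpos : 0 < ε_L := lt_min (by positivity) (div_pos hε'pos hQpos)
  have hε_L2 : ε_L ≤ ε / 2 := min_le_left _ _
  have hε_Lsmall : ε_L * (u : ℝ) ^ (t - 1) * (5 / c + 1 / (η * c ^ t)) ≤ ε' := by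
    have h := min_le_right (ε / 2) (ε' / Q)
    rw [← hε_L_def, le_div_iff₀ hQpos, hQ_def] at h
    simpa [mul_assoc] using h
  obtain ⟨N_L, hL⟩ := hLaw L u hu2 ε_L hε_Lpos
  refine ⟨u, hu2, max (max N_H N_M) (max N_L 2), ?_⟩
  intro N hN Ψ hΨ hsize K hK hKbox
  have hN_H : N_H ≤ N := le_trans (le_max_left _ _) (le_trans (le_max_left _ _) hN)
  have hN_M : N_M ≤ N := le_trans (le_max_right _ _) (le_trans (le_max_left _ _) hN)
  have hN_L : N_L ≤ N := le_trans (le_max_left _ _) (le_trans (le_max_right _ _) hN)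
  have hN2 : 2 ≤ N := le_trans (le_max_right _ _) (le_trans (le_max_right _ _) hN)
  have hNpos : (0 : ℝ) < N := by exact_mod_cast (by omega : 0 < N)
  have hlogpos : 0 < Real.log N := Real.log_pos (by exact_mod_cast (by omega : 1 < N))
  have hlogt : 0 < Real.log N ^ t := pow_pos hlogpos t
  obtain ⟨θ, hθ0, hθ2, hcells⟩ := hL N hN_L Ψ hΨ hsize K hK hKbox
  obtain ⟨hlow, hmarg, hbal⟩ := hMod N hN_M
  have hMS0' := hMS0 Ψ K hΨ
  -- densities `a m = A_m / N`
  set a : ℕ → ℝ := fun m => (A N u m : ℝ) / N with ha_def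
  have ha0 : ∀ m, 0 ≤ a m := fun m => div_nonneg (Nat.cast_nonneg _) hNpos.le
  have hlow' : ∀ m ∈ ({1, j₁ - 1, j₁, j₁ + 1, j₂ - 1, j₂, j₂ + 1} : Finset ℕ),
      c / Real.log N ≤ a m := fun m hm => density_lower hNpos (hlow m hm)
  have hclog : 0 < c / Real.log N := div_pos hc hlogpos
  have ha1pos : 0 < a 1 := lt_of_lt_of_le hclog (hlow' 1 (by simp))
  have hasum : ∑ m ∈ Finset.Icc 1 u, a m ≤ 1 := by
    have : ∑ m ∈ Finset.Icc 1 u, a m = (∑ m ∈ Finset.Icc 1 u, (A N u m : ℝ)) / N := by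
      rw [Finset.sum_div]
    rw [this, div_le_one hNpos]
    exact hAsum N u
  have ha1le : (A N u 1 : ℝ) / N ≤ 5 / Real.log N := by
    rw [div_le_div_iff₀ hNpos hlogpos]
    have := hA1 N u hN2
    rw [le_div_iff₀ hlogpos] at this
    linarith
  -- the prime cell
  have hprime : |(cell N u Ψ K (fun _ => 1) : ℝ) -
      (∑ S : Finset (Fin t), θ S * ∏ _i ∈ S, (-1 : ℝ) ^ (1 + 1)) *
        (MS Ψ K * ∏ _i : Fin t, (A N u 1 : ℝ) / N)| ≤
      ε_L * (MS Ψ K * ((A N u 1 : ℝ) / N) ^ t + N / Real.log N ^ t) :=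
    hcells (fun _ => 1) (fun _ => ⟨le_rfl, hu1⟩)
  have hprod1 : ∏ _i : Fin t, (A N u 1 : ℝ) / N = ((A N u 1 : ℝ) / N) ^ t := by
    rw [Finset.prod_const, Finset.card_univ, Fintype.card_fin]
  rw [hprod1] at hprime
  set Θ : ℝ := ∑ S : Finset (Fin t), θ S * ∏ _i ∈ S, (-1 : ℝ) ^ (1 + 1) with hΘ_def
  set X : ℝ := MS Ψ K * ((A N u 1 : ℝ) / N) ^ t with hX_def
  have hX0 : 0 ≤ X := mul_nonneg hMS0' (pow_nonneg (ha0 1) t)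
  have hNlog0 : 0 ≤ (N : ℝ) / Real.log N ^ t := by positivity
  -- the uniform per-cell error of the relative law at this `(N, Ψ, K)`
  set E₀ : ℝ := ε_L * (X + N / Real.log N ^ t) with hE₀_def
  have hE₀0 : 0 ≤ E₀ := mul_nonneg hε_Lpos.le (add_nonneg hX0 hNlog0)
  -- the key estimate in the two cases
  have hkey : |Θ - 1| * X ≤ ε / 2 * X + ε / 2 * (N / Real.log N ^ t) := by
    by_cases hcase : MS Ψ K < η * N
    · -- case A: small singular mass
      have hΘ1 : |Θ - 1| ≤ 2 ^ t * 2 :=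
        abs_walsh_primeCell_sub_one_le θ hθ0 (by norm_num) fun S _ => hθ2 S
      have hXle : X ≤ η * N * (5 / Real.log N) ^ t :=
        mul_le_mul hcase.le (pow_le_pow_left₀ (ha0 1) ha1le t) (pow_nonneg (ha0 1) t)
          (by positivity)
      have hid : (2 : ℝ) ^ t * 2 * (η * N * (5 / Real.log N) ^ t) = ε / 2 * (N / Real.log N ^ t) := by
        rw [hη_def, div_pow]
        field_simp
        ring
      calc |Θ - 1| * X ≤ 2 ^ t * 2 * (η * N * (5 / Real.log N) ^ t) :=
            mul_le_mul hΘ1 hXle hX0 (by positivity)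
        _ = ε / 2 * (N / Real.log N ^ t) := hid
        _ ≤ ε / 2 * X + ε / 2 * (N / Real.log N ^ t) :=
            le_add_of_nonneg_left (by positivity)
    · -- case B: the fibres are hyperbolic
      rw [not_lt] at hcase
      have hMSpos : 0 < MS Ψ K := lt_of_lt_of_le (by positivity) hcase
      have hτ : ∀ S : Finset (Fin t), S ≠ ∅ → |θ S| ≤ 8 ^ (t - 1) * (2 ^ t * δ + ε') := by
        refine theta_small_of_fibres θ fun i => ?_
        refine fibre_clip i hu1 θ hθ2 a ha0 ha1pos hasum hδ4
          (density_balance hNpos (fun n => (A N u n : ℝ)) hbal) hj₁ hj₂ h2j₁ (by omega) h2j₂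
          (by omega) (fun m hm => lt_of_lt_of_le hclog (hlow' m (Finset.mem_insert_of_mem hm)))
          hδpos.le hδ1 (fun m hm => density_margin hNpos (hmarg m hm))
          (fun j => (cell N u Ψ K j : ℝ)) (fun j => Nat.cast_nonneg _) hMSpos
          (E₀ := E₀) hE₀0 (fun j hj => ?_) ?_ hε'pos.le ?_
        · -- the relative law's error is the uniform `E₀`
          have h := hcells j fun k => Finset.mem_Icc.1 (Fintype.mem_piFinset.1 hj k)
          simpa [hE₀_def, hX_def, ha_def] using h
        · intro w hw z hz
          exact hH N hN_H Ψ hΨ hsize K hK hKbox hcase i w hw z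
            ((fibreSum_cast _ _ i w z).symm.trans hz)
        · intro m hm
          have h := RelConsumerAux.smallness_transfer_rel ht hNpos hlogpos hηpos hc
            hε_Lpos.le (pow_nonneg hupos.le (t - 1)) hcase
            (hlow' m (Finset.mem_insert_of_mem hm)) (hlow' 1 (by simp)) ha1le hε_Lsmall
          simpa [hE₀_def, hX_def, ha_def, mul_assoc, mul_comm, mul_left_comm] using h
      have hΘ1 : |Θ - 1| ≤ ε / 2 :=
        calc |Θ - 1| ≤ 2 ^ t * (8 ^ (t - 1) * (2 ^ t * δ + ε')) :=
              abs_walsh_primeCell_sub_one_le θ hθ0 (by positivity) hτ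
          _ = K₁ * (2 ^ t * δ) + K₁ * ε' := by rw [hK₁]; ring
          _ ≤ ε / 4 + ε / 4 := add_le_add hδK hε'K.le
          _ = ε / 2 := by ring
      calc |Θ - 1| * X ≤ ε / 2 * X := mul_le_mul_of_nonneg_right hΘ1 hX0
        _ ≤ ε / 2 * X + ε / 2 * (N / Real.log N ^ t) :=
            le_add_of_nonneg_right (by positivity)
  -- conclusion
  have hsplit : (cell N u Ψ K (fun _ => 1) : ℝ) - X =
      ((cell N u Ψ K (fun _ => 1) : ℝ) - Θ * X) + (Θ - 1) * X := by ring
  have hL2 : ε_L * (X + N / Real.log N ^ t) ≤ ε / 2 * (X + N / Real.log N ^ t) :=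
    mul_le_mul_of_nonneg_right hε_L2 (add_nonneg hX0 hNlog0)
  calc |(cell N u Ψ K (fun _ => 1) : ℝ) - X|
      = |((cell N u Ψ K (fun _ => 1) : ℝ) - Θ * X) + (Θ - 1) * X| := by rw [hsplit]
    _ ≤ |(cell N u Ψ K (fun _ => 1) : ℝ) - Θ * X| + |(Θ - 1) * X| := abs_add_le _ _
    _ ≤ ε_L * (X + N / Real.log N ^ t) + |Θ - 1| * X := by
        rw [abs_mul, abs_of_nonneg hX0]
        exact add_le_add hprime le_rfl
    _ ≤ ε / 2 * (X + N / Real.log N ^ t) + (ε / 2 * X + ε / 2 * (N / Real.log N ^ t)) :=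
        add_le_add hL2 hkey
    _ = ε * (X + N / Real.log N ^ t) := by ring

/-- **`stub_relativeConsumer`** (registered bookkeeping stub of skeleton v16, line `section-annihilator`): the
route's consumer of the crux goes through from the RELATIVE + absolute form —
`CellParityLawRel → FibreHyperbolicity → ModelCellFacts → PrimeCellsRelative`. The route's inlined objects (joint
rough `Ω`-cells, model cells, `β_∞ ∏_p β_p`) enter `clipsParity_assembly_rel` by unification, exactly as in the landed
`HyperbolicityClipsParity_proof`. Sorry-free. -/
theorem stub_relativeConsumer :
    CellParityLawRel →
      Summit.Parity.GeneralizedHardyLittlewood.Theses.LeeYangFibres.FibreHyperbolicity →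
      Summit.Parity.GeneralizedHardyLittlewood.Theses.LeeYangFibres.ModelCellFacts →
      Summit.Parity.GeneralizedHardyLittlewood.Theses.LeeYangFibres.PrimeCellsRelative := by
  intro hLaw hHyp hModel t L ht ε hε
  exact RelConsumerAux.clipsParity_assembly_rel ht
    (fun N u => sum_modelCells_le N u)
    (fun Ψ K hΨ => archFactor_mul_singularProduct_nonneg Ψ hΨ K)
    (fun L u hu ε hε => hLaw t L u ht hu ε hε) (fun L u₀ η hη => hHyp t L u₀ ht η hη) hModel
    (fun N u hN => modelCell_one_le hN u) L ε hε

/-- **The clipping lemma from the relative law** (curried, named form of `stub_relativeConsumer`). -/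
theorem primeCellsRelative_of_cellParityLawRel (hLaw : CellParityLawRel)
    (hHyp : Summit.Parity.GeneralizedHardyLittlewood.Theses.LeeYangFibres.FibreHyperbolicity)
    (hModel : Summit.Parity.GeneralizedHardyLittlewood.Theses.LeeYangFibres.ModelCellFacts) :
    Summit.Parity.GeneralizedHardyLittlewood.Theses.LeeYangFibres.PrimeCellsRelative :=
  stub_relativeConsumer hLaw hHyp hModel

end Summit.Parity.GeneralizedHardyLittlewood.Cruxes.CellParityLaw.SectionAnnihilator

end
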